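/-
Copyright (c) 2026. Released under Apache 2.0 license.
-/
import Mathlib.GroupTheory.Commutator.Basic
import Mathlib.Data.Nat.Choose.Dvd
import Mathlib.Tactic.Group
import HarnessLib

/-!
# Commutators with `p`-th powers when the double commutators are central and `p`-torsion

Elementary identities used in the layer analysis of the `p`-adic core of the invariant form of
[CalegariDimitrovTang2025, Corollary 4.5.3] (depth `e ≥ 3`, [Beyl1986]): if `z = [A,[A,B]]` is central then
`A^n B A^{-n} = z^{C(n,2)} [A,B]^n B`, hence `[A^p, B] = [A,B]^p` as soon as `z^p = 1` and `p` is an odd prime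
(`p ∣ C(p,2)`); symmetrically `[A, B^p] = [A,B]^p` when `[B,[A,B]]` is central and `p`-torsion.
-/

open scoped commutatorElement

namespace Literature.NumberTheory.Automorphic

namespace UnboundedDenominators

variable {G : Type*} [Group G]

/-- `A^k c A^{-k} = z^k c` for `z = [A, c]` central. [folklore] [cite: CalegariDimitrovTang2025, Corollary 4.5.3] -/
theorem pow_conj_eq_of_commutator_central (A c : G) (hz : ⁅A, c⁆ ∈ Subgroup.center G) (k : ℕ) :
    A ^ k * c * (A ^ k)⁻¹ = ⁅A, c⁆ ^ k * c := by
  have hzg : ∀ (m : ℕ) (g : G), g * ⁅A, c⁆ ^ m = ⁅A, c⁆ ^ m * g := fun m g ↦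
    Subgroup.mem_center_iff.mp (pow_mem hz m) g
  have hAc : A * c * A⁻¹ = ⁅A, c⁆ * c := by rw [commutatorElement_def]; group
  induction k with
  | zero => simp
  | succ k ih =>
    rw [pow_succ', show A * A ^ k * c * (A * A ^ k)⁻¹ = A * (A ^ k * c * (A ^ k)⁻¹) * A⁻¹ by group, ih,
      ← mul_assoc, hzg k A, show ⁅A, c⁆ ^ k * A * c * A⁻¹ = ⁅A, c⁆ ^ k * (A * c * A⁻¹) by group, hAc,
      ← mul_assoc, ← pow_succ]

/-- `A^n B A^{-n} = [A,[A,B]]^{C(n,2)} [A,B]^n B` when `[A,[A,B]]` is central. [folklore]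
[cite: CalegariDimitrovTang2025, Corollary 4.5.3] -/
theorem pow_mul_mul_pow_inv_eq (A B : G) (hz : ⁅A, ⁅A, B⁆⁆ ∈ Subgroup.center G) (n : ℕ) :
    A ^ n * B * (A ^ n)⁻¹ = ⁅A, ⁅A, B⁆⁆ ^ (n.choose 2) * ⁅A, B⁆ ^ n * B := by
  set c := ⁅A, B⁆ with hc
  have hzg : ∀ (m : ℕ) (g : G), g * ⁅A, c⁆ ^ m = ⁅A, c⁆ ^ m * g := fun m g ↦
    Subgroup.mem_center_iff.mp (pow_mem hz m) g
  have hAB : A * B * A⁻¹ = c * B := by rw [hc, commutatorElement_def]; group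
  induction n with
  | zero => simp
  | succ n ih =>
    rw [pow_succ, show A ^ n * A * B * (A ^ n * A)⁻¹ = A ^ n * (A * B * A⁻¹) * (A ^ n)⁻¹ by group, hAB,
      show A ^ n * (c * B) * (A ^ n)⁻¹ = (A ^ n * c * (A ^ n)⁻¹) * (A ^ n * B * (A ^ n)⁻¹) by group, ih,
      pow_conj_eq_of_commutator_central A c hz n, Nat.choose_succ_succ, Nat.choose_one_right, pow_add,
      pow_succ]
    -- `z^n c (z^{C} c^n B) = z^n z^C (c c^n) B`
    have h1 : ⁅A, c⁆ ^ n * c * (⁅A, c⁆ ^ n.choose 2 * c ^ n * B) =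
        ⁅A, c⁆ ^ n * (c * ⁅A, c⁆ ^ n.choose 2) * c ^ n * B := by group
    rw [h1, hzg (n.choose 2) c]
    group

/-- **`[A^p, B] = [A,B]^p`** when `[A,[A,B]]` is central with `[A,[A,B]]^p = 1` and `p` is an odd prime.
[cite: CalegariDimitrovTang2025, Corollary 4.5.3] [cite: Beyl1986, Theorem] -/
theorem commutatorElement_pow_left_eq {p : ℕ} (hp : p.Prime) (hp2 : p ≠ 2) (A B : G)
    (hz : ⁅A, ⁅A, B⁆⁆ ∈ Subgroup.center G) (hzp : ⁅A, ⁅A, B⁆⁆ ^ p = 1) : ⁅A ^ p, B⁆ = ⁅A, B⁆ ^ p := by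
  have hdvd : p ∣ p.choose 2 :=
    hp.dvd_choose_self two_ne_zero (lt_of_le_of_ne hp.two_le (Ne.symm hp2))
  obtain ⟨k, hk⟩ := hdvd
  rw [commutatorElement_def (A ^ p), pow_mul_mul_pow_inv_eq A B hz p, hk, pow_mul, hzp, one_pow, one_mul,
    mul_inv_cancel_right]

/-- `(c B)^n = [B,c]^{C(n,2)} c^n B^n` when `[B, c]` is central. [folklore]
[cite: CalegariDimitrovTang2025, Corollary 4.5.3] -/
theorem mul_pow_eq_of_commutator_central (B c : G) (hz : ⁅B, c⁆ ∈ Subgroup.center G) (n : ℕ) :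
    (c * B) ^ n = ⁅B, c⁆ ^ (n.choose 2) * c ^ n * B ^ n := by
  have hzg : ∀ (m : ℕ) (g : G), g * ⁅B, c⁆ ^ m = ⁅B, c⁆ ^ m * g := fun m g ↦
    Subgroup.mem_center_iff.mp (pow_mem hz m) g
  induction n with
  | zero => simp
  | succ n ih =>
    rw [pow_succ, ih, show ⁅B, c⁆ ^ n.choose 2 * c ^ n * B ^ n * (c * B) =
        ⁅B, c⁆ ^ n.choose 2 * c ^ n * (B ^ n * c * (B ^ n)⁻¹) * B ^ n * B by group,
      pow_conj_eq_of_commutator_central B c hz n, Nat.choose_succ_succ, Nat.choose_one_right, pow_add,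
      pow_succ, pow_succ]
    have h1 : ⁅B, c⁆ ^ n.choose 2 * c ^ n * (⁅B, c⁆ ^ n * c) * B ^ n * B =
        ⁅B, c⁆ ^ n.choose 2 * (c ^ n * ⁅B, c⁆ ^ n) * c * B ^ n * B := by group
    rw [h1, hzg n (c ^ n)]
    group

/-- **`[A, B^p] = [A,B]^p`** when `[B,[A,B]]` is central with `[B,[A,B]]^p = 1` and `p` is an odd prime.
[cite: CalegariDimitrovTang2025, Corollary 4.5.3] [cite: Beyl1986, Theorem] -/
theorem commutatorElement_pow_right_eq {p : ℕ} (hp : p.Prime) (hp2 : p ≠ 2) (A B : G)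
    (hz : ⁅B, ⁅A, B⁆⁆ ∈ Subgroup.center G) (hzp : ⁅B, ⁅A, B⁆⁆ ^ p = 1) : ⁅A, B ^ p⁆ = ⁅A, B⁆ ^ p := by
  have hdvd : p ∣ p.choose 2 :=
    hp.dvd_choose_self two_ne_zero (lt_of_le_of_ne hp.two_le (Ne.symm hp2))
  obtain ⟨k, hk⟩ := hdvd
  have hAB : A * B * A⁻¹ = ⁅A, B⁆ * B := by rw [commutatorElement_def]; group
  rw [commutatorElement_def A (B ^ p), ← conj_pow, hAB, mul_pow_eq_of_commutator_central B ⁅A, B⁆ hz p, hk,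
    pow_mul, hzp, one_pow, one_mul, mul_inv_cancel_right]

end UnboundedDenominators

end Literature.NumberTheory.Automorphic
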